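import Summits.Ventures.CertifiedQuantumChemistry.Rows.V2RDMDualKernelTerms
import HarnessLib

/-!
# Ventures/CertifiedQuantumChemistry — Rows/V2RDMDualKernelPack.lean: packed certificate literals decoded by the kernel, and two-electron tables regrouped for cheap kernel lookups (`fastModel_eq`: same model)

HONEST FRAMING (verbatim): certified bounds for a stated model Hamiltonian in a stated basis; not a
claim about the real molecule beyond that model.

PART OF `Rows/V2RDMDualKernel.lean` (rdm-A g61, KERNEL-SDP): the kernel-replayed v2RDM dual SDP certificate ⇒ `LowerRow`.
The development is split into `Rows/V2RDMDualKernelTerms.lean` → `…Residual.lean` → `…Blocks.lean`, `…Pack.lean` → `Rows/V2RDMDualKernel.lean`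
(the entry points `lowerRow_of_check` / `lowerRow_of_staged` and the full account live in the last file); one namespace
`Summit.Ventures.CertifiedQuantumChemistry.V2RDMDual` throughout, so declaration names do not depend on the file split.
-/

namespace Summit.Ventures.CertifiedQuantumChemistry

open Matrix Finset
open scoped ComplexOrder
open Literature.MathematicalPhysics.QuantumLattice Literature.MathematicalPhysics.QuantumChemistry

namespace V2RDMDual

/-! ## Packed literals: cheap to elaborate, decoded by the kernel (untrusted certificate data) -/

namespace Pack

/-- `cnt` little-endian base-`B` digits of `n`. -/
def digits (B : ℕ) : ℕ → ℕ → List ℕ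
  | 0, _ => []
  | c + 1, n => (n % B) :: digits B c (n / B)

/-- Integers `x − off` from base-`B` digits. -/
def ints (B off cnt n : ℕ) : List ℤ := (digits B cnt n).map fun x => (x : ℤ) - off

/-- Dyadic rationals `(x − off) / 2^e` from base-`B` digits. -/
def dyadics (B off e cnt n : ℕ) : List ℚ := (digits B cnt n).map fun x => (((x : ℤ) - off : ℤ) : ℚ) / (2 ^ e : ℚ)

/-- Rationals `(x − off) / D` from base-`B` digits. -/
def rats (B off D cnt n : ℕ) : List ℚ := (digits B cnt n).map fun x => (((x : ℤ) - off : ℤ) : ℚ) / (D : ℚ)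

/-- Integer rows with the given lengths from concatenated base-`B` digits. -/
def rows (B off : ℕ) : List ℕ → ℕ → List (List ℤ)
  | [], _ => []
  | len :: ls, n => ints B off len n :: rows B off ls (n / B ^ len)

/-- Index pairs, two base-`256` digits each. -/
def pairs : ℕ → ℕ → List (ℕ × ℕ)
  | 0, _ => []
  | c + 1, n => (n % 256, n / 256 % 256) :: pairs c (n / 65536)

/-- Lower-triangular integer rows (row `i` has `i + 1` entries) from concatenated base-`B` digits. -/
def tri (B off : ℕ) : ℕ → ℕ → ℕ → List (List ℤ)
  | 0, _, _ => []
  | c + 1, i, n => ints B off (i + 1) n :: tri B off c (i + 1) (n / B ^ (i + 1))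

/-- A descriptor from its code `t + 2·(x₁ + 64·x₂ + 64²·y₁ + 64³·y₂)` (`t = 0`: `one x₁ x₂`). -/
def desc (c : ℕ) : Desc :=
  if c % 2 = 0 then .one (c / 2 % 64) (c / 128 % 64)
  else .two (c / 2 % 64) (c / 128 % 64) (c / 8192 % 64) (c / 524288 % 64)

/-- Terms: coefficients `(x − off) / D` from base-`B` digits of `nc`, descriptor codes (base `2^25`) from `nd`. -/
def terms (B off D cnt nc nd : ℕ) : List Term :=
  List.zipWith (fun x dc => ((((x : ℤ) - off : ℤ) : ℚ) / (D : ℚ), desc dc)) (digits B cnt nc) (digits 33554432 cnt nd)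

end Pack

/-! ### Regrouped integral tables (cheaper kernel lookups, same model)
`Model.ofTables` reads `(pq|rs)` by a linear `List.lookup` over the whole canonical table; the kernel pays that scan
for every one of the `k⁴` index quadruples of the objective. A table REGROUPED by the first canonical pair
(`ETab2`, two-level lookup) that flattens back to the original table verbatim, with distinct outer keys, defines
the SAME model (`fastModel_eq`) — so certificate files expand the objective through it. -/

/-- A two-electron table regrouped by the first canonical pair: `[(ab, [(cd, v), …]), …]`. -/
abbrev ETab2 := List ((ℕ × ℕ) × List ((ℕ × ℕ) × (ℤ × ℕ)))

/-- Flatten a regrouped table back to the flat canonical table of `Model.ofTables`. -/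
def flatten2 : ETab2 → List (((ℕ × ℕ) × (ℕ × ℕ)) × (ℤ × ℕ))
  | [] => []
  | (a, grp) :: g => grp.map (fun e => ((a, e.1), e.2)) ++ flatten2 g

/-- Two-level lookup. -/
def lookup2 (g : ETab2) (κ : (ℕ × ℕ) × (ℕ × ℕ)) : Option (ℤ × ℕ) :=
  match g.lookup κ.1 with
  | some grp => grp.lookup κ.2
  | none => none

/-- `List.lookup` on a concatenation: the first list wins. -/
theorem lookup_append' {α β : Type} [BEq α] (a : α) :
    ∀ (l₁ l₂ : List (α × β)), (l₁ ++ l₂).lookup a =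
      (match l₁.lookup a with | some v => some v | none => l₂.lookup a)
  | [], l₂ => by simp [List.lookup]
  | (x, y) :: l₁, l₂ => by
    simp only [List.cons_append, List.lookup]
    cases a == x
    · simp only []
      exact lookup_append' a l₁ l₂
    · simp

/-- Lookup in a group re-keyed by a fixed outer key. -/
theorem lookup_map_key (a a' : ℕ × ℕ) (b : ℕ × ℕ) :
    ∀ (grp : List ((ℕ × ℕ) × (ℤ × ℕ))),
      (grp.map (fun e => ((a', e.1), e.2))).lookup (a, b) = if a = a' then grp.lookup b else none
  | [] => by simp [List.lookup]
  | (b', v) :: grp => by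
    simp only [List.map_cons, List.lookup]
    have ih := lookup_map_key a a' b grp
    by_cases h : a = a'
    · subst h
      by_cases hb : b = b'
      · subst hb; simp
      · have h1 : ((a, b) == (a, b')) = false := by simp [hb]
        have h2 : (b == b') = false := by simp [hb]
        simp only [h1, h2, ih, if_true]
    · have h1 : ((a, b) == (a', b')) = false := by simp [h]
      simp only [h1, ih, h, if_false]

/-- A pair whose outer key is absent from the regrouped table is absent from its flattening. -/
theorem lookup_flatten2_none (a b : ℕ × ℕ) :
    ∀ (g : ETab2), a ∉ g.map Prod.fst → (flatten2 g).lookup (a, b) = none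
  | [], _ => by simp [flatten2]
  | (a', grp) :: g, h => by
    simp only [List.map_cons, List.mem_cons, not_or] at h
    rw [flatten2, lookup_append', lookup_map_key, if_neg h.1]
    exact lookup_flatten2_none a b g h.2

/-- With distinct outer keys, the two-level lookup agrees with the flat lookup. -/
theorem lookup2_eq (κ : (ℕ × ℕ) × (ℕ × ℕ)) :
    ∀ (g : ETab2), (g.map Prod.fst).Nodup → lookup2 g κ = (flatten2 g).lookup κ
  | [], _ => by simp [lookup2, flatten2, List.lookup]
  | (a', grp) :: g, hnd => by
    obtain ⟨a, b⟩ := κ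
    simp only [List.map_cons, List.nodup_cons] at hnd
    rw [flatten2, lookup_append', lookup_map_key]
    by_cases h : a = a'
    · subst h
      simp only [lookup2, List.lookup, beq_self_eq_true, if_true]
      cases hg : grp.lookup b
      · simp only []
        exact (lookup_flatten2_none a b g hnd.1).symm
      · simp
    · have h1 : (a == a') = false := by simp [h]
      simp only [lookup2, List.lookup, h1, if_neg h]
      have ih := lookup2_eq (a, b) g hnd.2
      simp only [lookup2] at ih
      exact ih

/-- The table model read through a regrouped two-electron table. -/
def fastModel (k : ℕ) (hT : List ((ℕ × ℕ) × (ℤ × ℕ))) (g : ETab2) (ecore : ℚ) : Model k where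
  h p q := ((hT.lookup (pairKey p.val q.val)).map entryVal).getD 0
  eri p q r s := ((lookup2 g (quadKey p.val q.val r.val s.val)).map entryVal).getD 0
  ecore := ecore

/-- `fastModel` IS `Model.ofTables` of the flattened table (distinct outer keys). -/
theorem fastModel_eq (k : ℕ) (hT : List ((ℕ × ℕ) × (ℤ × ℕ))) (g : ETab2) (ecore : ℚ)
    (hnd : (g.map Prod.fst).Nodup) (eT : List (((ℕ × ℕ) × (ℕ × ℕ)) × (ℤ × ℕ))) (he : flatten2 g = eT) :
    fastModel k hT g ecore = Model.ofTables k hT eT ecore := by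
  subst he
  simp only [fastModel, Model.ofTables, lookup2_eq _ g hnd]

end V2RDMDual

end Summit.Ventures.CertifiedQuantumChemistry
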